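import Mathlib.Algebra.Ring.Equiv
import Mathlib.Algebra.Ring.Prod
import Mathlib.Algebra.Ring.Pi
import Mathlib.Data.Prod.Lex
import Mathlib.Data.Fintype.Option
import Mathlib.Tactic.Ring
import Mathlib.Tactic.LinearCombination
import Literature.Algebra.EuclideanDomain.TransfiniteSmallestAlgorithm
import HarnessLib

/-!
# A finite product of (transfinite) Euclidean rings is Euclidean (Samuel 1971, Proposition 6)

Topic `Literature/Algebra/EuclideanDomain`, namespace `Literature.Algebra.EuclideanDomain`.  THEOREMS ONLY (no `def`, no
instance, no named fact), all proved.  The special case of two `ℕ`-Euclidean factors (values in `ℕ ×ₗ (ℕ ×ₗ ℕ)`) and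
`ℤ × ℤ` is `IntProdIntTransfiniteEuclidean.lean`; here the factors carry ARBITRARY (transfinite) algorithms, as in the
printed proposition, and the conclusion is also phrased with Samuel's transfinite construction
(`TransfiniteSmallestAlgorithm.lean`): the product is exhausted by its construction.

## Source (read at the page)

P. Samuel, *About Euclidean rings*, J. Algebra **19** (1971) 282–301 [Samuel1971] (materialised
`paper:doi-10-1016-0021-8693-71-90110-4`, pp. 285–286), VERBATIM.  **Proposition 6.** «A product of a finite number of
Euclidean rings is euclidean.»  Proof: «By induction we are reduced to the case of a product of two factors,
`A = A₁ × A₂`.  Let `Aᵢ` be Euclidean for `φᵢ : Aᵢ → Wᵢ` (`i = 1, 2`).  Let `W′ = W₁ × W₂` lexicographically ordered …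
Call `W` the “ordinal sum” of two copies of `W′`: this is a well-ordered set together with order-preserving injections
`h′, h″ : W′ → W` such that `h′(λ) < h″(μ)` for all `λ, μ ∈ W′`.  We define `φ : A₁ × A₂ → W` as follows: (i) If none or
both of `x₁, x₂` are `0`, `φ(x₁, x₂) = h′((φ₁(x₁), φ₂(x₂)))`, (ii) If just one of `x₁, x₂` is `0`,
`φ(x₁, x₂) = h″((φ₁(x₁), φ₂(x₂)))`.  We now show that `φ` is an algorithm on `A₁ × A₂`.  Consider `b = (b₁, b₂) ≠ 0` …
Suppose first that `b₁ ≠ 0`, `b₂ ≠ 0` and write `aᵢ = bᵢqᵢ + rᵢ` with `φᵢ(rᵢ) < φᵢ(bᵢ)` for `i = 1, 2`.  If none or both of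
`r₁, r₂` are `0`, we have `φ(r₁, r₂) = h′((φ₁(r₁), φ₂(r₂))) < h′((φ₁(b₁), φ₂(b₂))) = φ(b)` … If `r₁ = 0` and `r₂ ≠ 0` we
write `a₁ = b₁(q₁ − 1) + b₁` … and take `r = (b₁, r₂)`, `q = (q₁ − 1, q₂)`; then `φ(r) = h′((φ₁(b₁), φ₂(r₂))) <
h′((φ₁(b₁), φ₂(b₂))) = φ(b)`.  The case `r₁ ≠ 0`, `r₂ = 0` is treated in a similar way.  Suppose now that `b₁ = 0`,
`b₂ ≠ 0`.  If `a₁ ≠ 0`, we write `a₂ = b₂q₂ + r₂` with `r₂ ≠ 0` (this is possible if we exclude the trivial case in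
which `A₂` is the zero ring); taking `r = (a₁, r₂)` and `q = (0, q₂)`, we then have `φ(r) ∈ h′(W′)`, `φ(b) ∈ h″(W′)`,
whence `φ(r) < φ(b)`.  If `a₁ = 0`, we write `a₂ = b₂q₂ + r₂` with `φ₂(r₂) < φ₂(b₂)`, and take `r = (0, r₂)`,
`q = (0, q₂)`; then `φ(r) = h″((φ₁(0), φ₂(r₂))) < h″((φ₁(0), φ₂(b₂))) = φ(b)`.  The case `b₁ ≠ 0`, `b₂ = 0` is treated
in a similar way.  QED.»

## What is formalised

* «ordinal sum of two copies of `W′`» = `ℕ ×ₗ (W₁ ×ₗ W₂)` with first coordinate `ε ∈ {0, 1}` (`h′ ↔ ε = 0`,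
  `h″ ↔ ε = 1`); `φ(x) = (ε(x), (φ₁(x₁), φ₂(x₂)))` with `ε(x) = 0` iff none or both of `x₁, x₂` are `0`.
* §1 an algorithm transports along a ring isomorphism (`algorithm_comp_ringEquiv_symm`); §2 **the two-factor step
  with arbitrary value types** (`Prod.exists_algorithm`, Samuel's case analysis verbatim; `W₁`, `W₂` need only `<`),
  its ordinal-valued form `Prod.exists_ordinal_algorithm`, and the transfinite-construction form
  `Prod.forall_exists_mem_samuelSet` (both factors exhausted ⟹ the product exhausted); §3 **Proposition 6 for a finite
  family** `Pi.exists_ordinal_algorithm` / `Pi.forall_exists_mem_samuelSet` («By induction we are reduced to the case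
  of a product of two factors»: `Fintype.induction_empty_option`, `RingEquiv.piOptionEquivProd`,
  `RingEquiv.piCongrLeft`).
* The «trivial case in which `A₂` is the zero ring» needs no hypothesis: `b = (0, b₂)` with `b₂ ≠ 0` already makes
  `A₂` non-trivial, and the non-zero remainder is `r₂` or, if `r₂ = 0`, `b₂` itself (`exists_eq_mul_add_ne_zero_of_algorithm`).

## Mathlib / tree search

Mathlib: `Prod.Lex` (`toLex_lt_toLex`, `WellFoundedLT (α ×ₗ β)`), `RingEquiv.piOptionEquivProd`,
`RingEquiv.piCongrLeft`, `Fintype.induction_empty_option`; nothing on Euclidean products (`EuclideanDomain` has no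
product instance — a product of domains is not a domain).  Tree: `IntProdIntTransfiniteEuclidean.lean`
(`IntProd.Prod.exists_transfinite_algorithm` for `ℕ`-Euclidean factors, `ℤ × ℤ`), `TransfiniteSmallestAlgorithm.lean`
(`samuelRank_isAlgorithm`, `exists_mem_samuelSet_of_algorithm`, `exists_ordinal_algorithm_of_algorithm`),
`NormalisedEuclideanAlgorithm.lean` (Samuel §2 for `W`-valued algorithms).
-/

namespace Literature.Algebra.EuclideanDomain

universe u v w

/-! ## §1 Transport along ring isomorphisms; a non-zero remainder -/

/-- An algorithm transports along a ring isomorphism: if `φ` satisfies (E) on `R` and `e : R ≃+* S`, then `φ ∘ e⁻¹`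
satisfies (E) on `S` (Samuel: «Isomorphic algorithms have obviously the same properties»).
[cite: Samuel1971, §4 (p. 288)] -/
theorem algorithm_comp_ringEquiv_symm {R S : Type*} [CommRing R] [CommRing S] {W : Type*} [LT W] (e : R ≃+* S)
    {φ : R → W} (hφ : ∀ a b : R, b ≠ 0 → ∃ q r : R, a = b * q + r ∧ φ r < φ b) :
    ∀ a b : S, b ≠ 0 → ∃ q r : S, a = b * q + r ∧ φ (e.symm r) < φ (e.symm b) := by
  intro a b hb
  have hb' : e.symm b ≠ 0 := fun h ↦ hb (by simpa using congrArg e h)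
  obtain ⟨q, r, h, hr⟩ := hφ (e.symm a) (e.symm b) hb'
  refine ⟨e q, e r, e.symm.injective ?_, by simpa using hr⟩
  simp [map_add, map_mul, h]

/-- Division with a NON-ZERO remainder of value `≤ φ(b)` («write `a₂ = b₂q₂ + r₂` with `r₂ ≠ 0`»: if the remainder
vanishes use `b` itself and `q − 1`). [cite: Samuel1971, Prop. 6 (p. 286)] -/
theorem exists_eq_mul_add_ne_zero_of_algorithm {R : Type*} [CommRing R] {W : Type*} [Preorder W] {φ : R → W}
    (hφ : ∀ a b : R, b ≠ 0 → ∃ q r : R, a = b * q + r ∧ φ r < φ b) (a b : R) (hb : b ≠ 0) :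
    ∃ q r : R, a = b * q + r ∧ r ≠ 0 ∧ φ r ≤ φ b := by
  obtain ⟨q, r, hqr, hlt⟩ := hφ a b hb
  by_cases hr : r = 0
  · exact ⟨q - 1, b, by rw [hqr, hr]; ring, hb, le_rfl⟩
  · exact ⟨q, r, hqr, hr, hlt.le⟩

/-! ## §2 Two factors -/

/-- Comparison in the «ordinal sum of two copies of `W₁ × W₂`», realised as `ℕ ×ₗ (W₁ ×ₗ W₂)`.
[cite: Samuel1971, Prop. 6 (p. 286)] -/
theorem toLex_lt_toLex_iff {W₁ : Type*} {W₂ : Type*} [LT W₁] [LT W₂] (i i' : ℕ) (x x' : W₁) (y y' : W₂) :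
    (toLex (i, toLex (x, y)) : ℕ ×ₗ (W₁ ×ₗ W₂)) < toLex (i', toLex (x', y')) ↔
      i < i' ∨ i = i' ∧ (x < x' ∨ x = x' ∧ y < y') := by
  simp only [Prod.Lex.toLex_lt_toLex]

/-- **Proposition 6, two factors, arbitrary value types.**  If `φᵢ : Aᵢ → Wᵢ` are algorithms (`i = 1, 2`; only `<` on
`Wᵢ` is used), then `φ(x₁, x₂) = (ε, (φ₁ x₁, φ₂ x₂)) ∈ ℕ ×ₗ (W₁ ×ₗ W₂)` — `ε = 0` if none or both of `x₁, x₂` are `0`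
(Samuel's `h′`), `ε = 1` if just one of them is (`h″`) — is an algorithm on `A₁ × A₂`; the proof is Samuel's case
analysis. [cite: Samuel1971, Prop. 6 (pp. 285–286)] -/
theorem Prod.exists_algorithm {A₁ : Type*} {A₂ : Type*} [CommRing A₁] [CommRing A₂] {W₁ : Type*} {W₂ : Type*}
    [Preorder W₁] [Preorder W₂] (φ₁ : A₁ → W₁)
    (h₁ : ∀ a b : A₁, b ≠ 0 → ∃ q r : A₁, a = b * q + r ∧ φ₁ r < φ₁ b) (φ₂ : A₂ → W₂)
    (h₂ : ∀ a b : A₂, b ≠ 0 → ∃ q r : A₂, a = b * q + r ∧ φ₂ r < φ₂ b) :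
    ∃ φ : A₁ × A₂ → ℕ ×ₗ (W₁ ×ₗ W₂),
      ∀ a b : A₁ × A₂, b ≠ 0 → ∃ q r : A₁ × A₂, a = b * q + r ∧ φ r < φ b := by
  classical
  refine ⟨fun x ↦ toLex (if (x.1 = 0 ↔ x.2 = 0) then 0 else 1, toLex (φ₁ x.1, φ₂ x.2)), ?_⟩
  rintro ⟨a₁, a₂⟩ ⟨b₁, b₂⟩ hb
  simp only [ne_eq, Prod.mk_eq_zero, not_and_or] at hb
  by_cases hb1 : b₁ = 0
  · -- `b = (0, b₂)`, `b₂ ≠ 0`: `φ(b) = h″(φ₁ 0, φ₂ b₂)`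
    have hb2 : b₂ ≠ 0 := by tauto
    subst hb1
    by_cases ha1 : a₁ = 0
    · -- `a₁ = 0`: `r = (0, r₂)` with `φ₂ r₂ < φ₂ b₂`
      subst ha1
      obtain ⟨q₂, r₂, h, hr⟩ := h₂ a₂ b₂ hb2
      refine ⟨(0, q₂), (0, r₂),
        by simp only [Prod.mk_mul_mk, Prod.mk_add_mk, Prod.mk.injEq]; exact ⟨by ring, by linear_combination h⟩, ?_⟩
      simp only [toLex_lt_toLex_iff]
      by_cases hr0 : r₂ = 0
      · subst hr0; left; simp [hb2]
      · right; simp [hr0, hb2, hr]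
    · -- `a₁ ≠ 0`: `r = (a₁, r₂)` with `r₂ ≠ 0`, `φ(r) ∈ h′(W′)`, `φ(b) ∈ h″(W′)`
      obtain ⟨q₂, r₂, h, hr, -⟩ := exists_eq_mul_add_ne_zero_of_algorithm h₂ a₂ b₂ hb2
      refine ⟨(0, q₂), (a₁, r₂),
        by simp only [Prod.mk_mul_mk, Prod.mk_add_mk, Prod.mk.injEq]; exact ⟨by ring, by linear_combination h⟩, ?_⟩
      simp only [toLex_lt_toLex_iff]
      left; simp [ha1, hr, hb2]
  by_cases hb2 : b₂ = 0
  · -- `b = (b₁, 0)`, `b₁ ≠ 0`: symmetric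
    subst hb2
    by_cases ha2 : a₂ = 0
    · subst ha2
      obtain ⟨q₁, r₁, h, hr⟩ := h₁ a₁ b₁ hb1
      refine ⟨(q₁, 0), (r₁, 0),
        by simp only [Prod.mk_mul_mk, Prod.mk_add_mk, Prod.mk.injEq]; exact ⟨by linear_combination h, by ring⟩, ?_⟩
      simp only [toLex_lt_toLex_iff]
      by_cases hr0 : r₁ = 0
      · subst hr0; left; simp [hb1]
      · right
        exact ⟨by simp [hr0, hb1], Or.inl hr⟩
    · obtain ⟨q₁, r₁, h, hr, -⟩ := exists_eq_mul_add_ne_zero_of_algorithm h₁ a₁ b₁ hb1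
      refine ⟨(q₁, 0), (r₁, a₂),
        by simp only [Prod.mk_mul_mk, Prod.mk_add_mk, Prod.mk.injEq]; exact ⟨by linear_combination h, by ring⟩, ?_⟩
      simp only [toLex_lt_toLex_iff]
      left; simp [ha2, hr, hb1]
  · -- `b₁ ≠ 0 ≠ b₂`: `φ(b) = h′(φ₁ b₁, φ₂ b₂)`
    obtain ⟨q₁, r₁, e1, hlt1⟩ := h₁ a₁ b₁ hb1
    obtain ⟨q₂, r₂, e2, hlt2⟩ := h₂ a₂ b₂ hb2
    by_cases hr10 : r₁ = 0
    · by_cases hr20 : r₂ = 0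
      · -- both remainders vanish: `r = (0, 0)`
        refine ⟨(q₁, q₂), (0, 0), by
          simp only [Prod.mk_mul_mk, Prod.mk_add_mk, Prod.mk.injEq]
          exact ⟨by linear_combination e1 + hr10, by linear_combination e2 + hr20⟩, ?_⟩
        simp only [toLex_lt_toLex_iff]
        right
        refine ⟨by simp [hb1, hb2], Or.inl ?_⟩
        rw [← hr10]; exact hlt1
      · -- `r₁ = 0 ≠ r₂`: «we write `a₁ = b₁(q₁ − 1) + b₁`», `r = (b₁, r₂)`
        refine ⟨(q₁ - 1, q₂), (b₁, r₂), by
          simp only [Prod.mk_mul_mk, Prod.mk_add_mk, Prod.mk.injEq]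
          exact ⟨by linear_combination e1 + hr10, by linear_combination e2⟩, ?_⟩
        simp only [toLex_lt_toLex_iff]
        right; simp [hb1, hb2, hr20, hlt2]
    · by_cases hr20 : r₂ = 0
      · refine ⟨(q₁, q₂ - 1), (r₁, b₂), by
          simp only [Prod.mk_mul_mk, Prod.mk_add_mk, Prod.mk.injEq]
          exact ⟨by linear_combination e1, by linear_combination e2 + hr20⟩, ?_⟩
        simp only [toLex_lt_toLex_iff]
        right; simp [hb1, hb2, hr10, hlt1]
      · refine ⟨(q₁, q₂), (r₁, r₂), by
          simp only [Prod.mk_mul_mk, Prod.mk_add_mk, Prod.mk.injEq]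
          exact ⟨by linear_combination e1, by linear_combination e2⟩, ?_⟩
        simp only [toLex_lt_toLex_iff]
        right; simp [hb1, hb2, hr10, hr20, hlt1]

/-- Proposition 6 for two factors, ordinal-valued: if `A₁`, `A₂` carry algorithms (values in any well-founded orders)
then `A₁ × A₂` carries an algorithm with values in the ordinals of its universe. [cite: Samuel1971, Prop. 6 (pp. 285–286)] -/
theorem Prod.exists_ordinal_algorithm {A₁ : Type u} {A₂ : Type v} [CommRing A₁] [CommRing A₂]
    {W₁ : Type*} {W₂ : Type*} [Preorder W₁] [WellFoundedLT W₁] [Preorder W₂] [WellFoundedLT W₂] (φ₁ : A₁ → W₁)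
    (h₁ : ∀ a b : A₁, b ≠ 0 → ∃ q r : A₁, a = b * q + r ∧ φ₁ r < φ₁ b) (φ₂ : A₂ → W₂)
    (h₂ : ∀ a b : A₂, b ≠ 0 → ∃ q r : A₂, a = b * q + r ∧ φ₂ r < φ₂ b) :
    ∃ ψ : A₁ × A₂ → Ordinal.{max u v}, ∀ a b : A₁ × A₂, b ≠ 0 → ∃ q r : A₁ × A₂, a = b * q + r ∧ ψ r < ψ b := by
  obtain ⟨φ, hφ⟩ := Prod.exists_algorithm φ₁ h₁ φ₂ h₂
  exact exists_ordinal_algorithm_of_algorithm φ hφ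

/-- Proposition 6 for two factors in terms of the transfinite construction: if the constructions of `A₁` and `A₂`
exhaust them, the construction of `A₁ × A₂` exhausts it. [cite: Samuel1971, Prop. 6 (pp. 285–286) and §4 (p. 289)] -/
theorem Prod.forall_exists_mem_samuelSet {A₁ : Type u} {A₂ : Type v} [CommRing A₁] [CommRing A₂]
    (h₁ : ∀ x : A₁, ∃ α : Ordinal.{u}, x ∈ samuelSet A₁ α) (h₂ : ∀ x : A₂, ∃ α : Ordinal.{v}, x ∈ samuelSet A₂ α) :
    ∀ x : A₁ × A₂, ∃ α : Ordinal.{max u v}, x ∈ samuelSet (A₁ × A₂) α := by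
  obtain ⟨φ, hφ⟩ := Prod.exists_algorithm samuelRank (samuelRank_isAlgorithm h₁) samuelRank (samuelRank_isAlgorithm h₂)
  exact exists_mem_samuelSet_of_algorithm φ hφ

/-! ## §3 «By induction we are reduced to the case of a product of two factors» -/

/-- **Proposition 6.** «A product of a finite number of Euclidean rings is euclidean»: if every `A i` (`i` in a finite
index type) carries an ordinal-valued algorithm, so does `Π i, A i` (induction over the index type:
`Π_{Option ι} ≅ A none × Π_ι`, two-factor step, transport along `≃+*`). [cite: Samuel1971, Prop. 6 (pp. 285–286)] -/
theorem Pi.exists_ordinal_algorithm {ι : Type u} [Finite ι] {A : ι → Type v} [∀ i, CommRing (A i)]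
    (h : ∀ i, ∃ φ : A i → Ordinal.{v}, ∀ a b : A i, b ≠ 0 → ∃ q r : A i, a = b * q + r ∧ φ r < φ b) :
    ∃ ψ : (Π i, A i) → Ordinal.{max u v},
      ∀ a b : (Π i, A i), b ≠ 0 → ∃ q r : (Π i, A i), a = b * q + r ∧ ψ r < ψ b := by
  cases nonempty_fintype ι
  -- the statement, as a predicate on the (finite) index type
  let P : ∀ (α : Type u) [Fintype α], Prop := fun α _ ↦
    ∀ (B : α → Type v) [∀ i, CommRing (B i)],
      (∀ i, ∃ φ : B i → Ordinal.{v}, ∀ a b : B i, b ≠ 0 → ∃ q r : B i, a = b * q + r ∧ φ r < φ b) →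
        ∃ ψ : (Π i, B i) → Ordinal.{max u v},
          ∀ a b : (Π i, B i), b ≠ 0 → ∃ q r : (Π i, B i), a = b * q + r ∧ ψ r < ψ b
  suffices H : P ι from H A h
  refine Fintype.induction_empty_option (P := P) ?_ ?_ ?_ ι
  · -- invariance under `α ≃ β`
    intro α β _ e hα B _ hB
    obtain ⟨ψ, hψ⟩ := hα (fun a ↦ B (e a)) (fun a ↦ hB (e a))
    exact exists_ordinal_algorithm_of_algorithm _
      (algorithm_comp_ringEquiv_symm (RingEquiv.piCongrLeft B e) hψ)
  · -- the empty product is the zero ring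
    intro B _ _
    refine ⟨fun _ ↦ 0, fun a b hb ↦ ?_⟩
    exact absurd (funext fun i ↦ (PEmpty.elim i : b i = (0 : Π i, B i) i)) hb
  · -- `Π_{Option α} B ≅ B none × Π_α B (some ·)`
    intro α _ hα B _ hB
    obtain ⟨ψ', hψ'⟩ := hα (fun a ↦ B (some a)) (fun a ↦ hB (some a))
    obtain ⟨φ₀, hφ₀⟩ := hB none
    obtain ⟨φ, hφ⟩ := Prod.exists_algorithm φ₀ hφ₀ ψ' hψ'
    exact exists_ordinal_algorithm_of_algorithm _
      (algorithm_comp_ringEquiv_symm (RingEquiv.piOptionEquivProd (R := B)).symm hφ)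

/-- Proposition 6 in terms of the transfinite construction: if every factor is exhausted by its construction, so is
the (finite) product. [cite: Samuel1971, Prop. 6 (pp. 285–286) and §4 (p. 289)] -/
theorem Pi.forall_exists_mem_samuelSet {ι : Type u} [Finite ι] {A : ι → Type v} [∀ i, CommRing (A i)]
    (h : ∀ i, ∀ x : A i, ∃ α : Ordinal.{v}, x ∈ samuelSet (A i) α) :
    ∀ x : (Π i, A i), ∃ α : Ordinal.{max u v}, x ∈ samuelSet (Π i, A i) α := by
  obtain ⟨ψ, hψ⟩ := Pi.exists_ordinal_algorithm (A := A) fun i ↦ ⟨samuelRank, samuelRank_isAlgorithm (h i)⟩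
  exact exists_mem_samuelSet_of_algorithm ψ hψ

end Literature.Algebra.EuclideanDomain
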